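import Literature.Analysis.FluidPDE.NSKatoToClayHolds
import Literature.Analysis.FluidPDE.NSCriticalClosureBesovKatoClass
import Literature.Analysis.FluidPDE.NSLerayHopf
import Summits.NavierStokesRegularity.NavierStokesRegularity.Theorems.CertifiedBlowupCertifiedBlowupAxisymBlowupStubMaximal

/-!
# The datum-wise Clay dichotomy `ClayOrBlowup` — crux stmt-NavierStokesRegularity-0727
(`CertifiedBlowup.CertifiedBlowupAxisymBlowup`), line `compact-amplification`

Theorems file landed `--supports stmt-NavierStokesRegularity-0727` (strategist residue S1 of the
crux census `Cruxes/CertifiedBlowupAxisymBlowup/STRATEGY-CENSUS.md`: "file ClayOrBlowup as support").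
It is the bookkeeping half of the decomposition `CertifiedBlowupAxisymBlowup ⇐ ClayOrBlowup ∧ ¬AX`
and, with the kill edge, turns the crux into the exact negation of the registered conjecture leaf
`AxisymmetricSwirlRegularity` (see `…IffNotAxisymRegular.lean`).

**Statement (`clayOrBlowup`).** For `ν > 0` and every smooth, divergence-free, rapidly decaying
datum `u₀ : ℝ³ → ℝ³`, EITHER the unforced Navier–Stokes system has a global classical solution
`(u, p)` on `ℝ³ × [0, ∞)` with `u 0 = u₀` and bounded energy (Fefferman's (A) for this datum), OR
`u₀` launches a maximal smooth solution `(u, p)` of finite lifespan `T` (`IsMaximalSmoothSolution`: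
classical on `[0, T)`, no classical continuation past `T`) which is Leray–Hopf on `[0, T]` from
`u₀` (the blow-up format of X5a / X5a_axi).

**Proof.** Dichotomy on Kato's maximal time `T_max = katoMaximalTime ν u₀` of the datum in
`C_t L³_x`. If `T_max = ∞`, the datum has a global Kato solution
(`hasGlobalKatoSolution_of_katoMaximalTime_eq_top`, `kato_unique_holds`) and von Wahl's regularity
of the Kato class (`clay_solution_of_hasGlobalKatoSolution_holds`, Lemarié-Rieusset 2016 Prop. 12.3,
Kato 1984 Thm. 4) gives the Clay solution, converted to the `IsClassicalNSSolutionOn (Ici 0)` format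
by `isNavierStokesSolution_and_smooth_iff`. If `T_max < ∞`, put `T := T_max + 1`; a Tao-class
solution on `[0, T]` would be a Kato solution on `[0, T)` (`isKatoSolutionOn_of_classical`), forcing
`T ≤ T_max` — absurd; so the datum admits no Tao-class solution on `[0, T]`, and the landed stub
`stub_maximal` (Leray–Hopf maximal development, this line) produces the maximal Leray–Hopf solution
of lifespan `T* ≤ T` from `u₀`.

## References

* J. Leray, Acta Math. 63 (1934), Ch. V §§31–34 (structure theorem).
* T. Kato, Math. Z. 187 (1984), Thms. 1, 4.
* P. G. Lemarié-Rieusset, *The Navier–Stokes Problem in the 21st Century*, CRC 2016, Thm. 7.2,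
  Prop. 12.3, Thm. 15.1.
* C. Fefferman, *Existence and smoothness of the Navier–Stokes equation*, Clay 2000/2006, (A).
-/

set_option linter.dupNamespace false

noncomputable section

open MeasureTheory Set Function Filter Topology Metric
open scoped ENNReal NNReal ContDiff

namespace Summit.NavierStokesRegularity.NavierStokesRegularity.Theorems.CertifiedBlowupAxisymBlowup.CompactAmplification

open Literature.Analysis.FluidPDE

/-- **A Tao-class solution bounds Kato's maximal time from below.** If the smooth rapidly
decaying datum `u₀` has a Tao-class solution on the closed slab `[0, T]`, `T > 0`, then
`T ≤ T_max(u₀)`: the solution is classical on `[0, T)` and Leray–Hopf on `[0, T]` from `u₀ = u 0`,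
hence a Kato `C_t L³_x` solution on `[0, T)` (`isKatoSolutionOn_of_classical`), and every Kato
solution witnesses `T ≤ T_max`. [cite: LemarieRieusset2016, Thm. 15.1 (A)-(B)] -/
theorem clayOrBlowup_ofReal_le_katoMaximalTime {ν T : ℝ} (hν : 0 < ν) (hT : 0 < T)
    {u₀ : EuclideanSpace ℝ (Fin 3) → EuclideanSpace ℝ (Fin 3)} (hdec : HasRapidSpatialDecay u₀)
    {u : ℝ → EuclideanSpace ℝ (Fin 3) → EuclideanSpace ℝ (Fin 3)}
    {p : ℝ → EuclideanSpace ℝ (Fin 3) → ℝ}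
    (hup : IsTaoSolutionOn T ν u₀ u p) : ENNReal.ofReal T ≤ katoMaximalTime ν u₀ := by
  have hcl : IsClassicalNSSolutionOn (Ico 0 T) ν 0 u p :=
    hup.classical.mono (fun t ht => ⟨ht.1, ht.2.le⟩) (uniqueDiffOn_Ico 0 T)
  have h0 : u 0 = u₀ := hup.initial
  have hLH : IsLerayHopfOn T ν 0 (u 0) u := by rw [h0]; exact hup.isLerayHopfOn hT
  have hdec' : HasRapidSpatialDecay (u 0) := by rw [h0]; exact hdec
  have hK : IsKatoSolutionOn T ν (u 0) u := isKatoSolutionOn_of_classical hν hT hcl hLH hdec'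
  rw [h0] at hK
  exact hK.ofReal_le_katoMaximalTime

/-- **The datum-wise Clay dichotomy `ClayOrBlowup` (Leray's structure theorem in Kato's
formulation).** For `ν > 0` and a smooth, divergence-free, rapidly decaying datum `u₀` on `ℝ³`:
either there is a global classical solution `(u, p)` of the unforced Navier–Stokes system on
`ℝ³ × [0, ∞)` with `u 0 = u₀` and bounded energy, or there are a finite lifespan `T > 0` and a
maximal smooth solution `(u, p)` on `[0, T)` (no classical continuation past `T`) which is
Leray–Hopf on `[0, T]` from `u₀` and attains `u₀` at `t = 0`. Dichotomy on `katoMaximalTime ν u₀`: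
infinite ⇒ global Kato solution ⇒ Clay solution (von Wahl,
`clay_solution_of_hasGlobalKatoSolution_holds`);
finite ⇒ no Tao-class solution on `[0, T_max + 1]` (`clayOrBlowup_ofReal_le_katoMaximalTime`) ⇒
maximal Leray–Hopf development (`stub_maximal`). See the module docstring.
[cite: LemarieRieusset2016, Prop. 12.3 and Thm. 15.1] -/
theorem clayOrBlowup :
    ∀ ν : ℝ, 0 < ν → ∀ u₀ : EuclideanSpace ℝ (Fin 3) → EuclideanSpace ℝ (Fin 3),
      ContDiff ℝ ∞ u₀ → VectorCalculus.IsDivFree u₀ → HasRapidSpatialDecay u₀ →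
      (∃ (u : ℝ → EuclideanSpace ℝ (Fin 3) → EuclideanSpace ℝ (Fin 3))
          (p : ℝ → EuclideanSpace ℝ (Fin 3) → ℝ),
          IsClassicalNSSolutionOn (Set.Ici 0) ν 0 u p ∧ u 0 = u₀ ∧ HasBoundedEnergy u) ∨
      (∃ T : ℝ, 0 < T ∧ ∃ (u : ℝ → EuclideanSpace ℝ (Fin 3) → EuclideanSpace ℝ (Fin 3))
          (p : ℝ → EuclideanSpace ℝ (Fin 3) → ℝ),
          IsMaximalSmoothSolution ν 0 u p T ∧ IsLerayHopfOn T ν 0 u₀ u ∧ u 0 = u₀) := by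
  intro ν hν u₀ hsm hdiv hdec
  classical
  have hdivW : NSWave0.IsDivFree u₀ := fun x => hdiv x
  by_cases htop : katoMaximalTime ν u₀ = ⊤
  · -- global Kato solution ⇒ Clay solution
    left
    obtain ⟨u, p, hu, hp, hns, hbe⟩ :=
      clay_solution_of_hasGlobalKatoSolution_holds ν hν u₀ hsm hdivW hdec
        (hasGlobalKatoSolution_of_katoMaximalTime_eq_top kato_unique_holds hν htop)
    obtain ⟨hcl, h0⟩ := isNavierStokesSolution_and_smooth_iff.1 ⟨hns, hu, hp⟩
    exact ⟨u, p, hcl, h0, hbe⟩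
  · -- finite maximal time ⇒ no Tao-class solution on `[0, T_max + 1]` ⇒ maximal development
    right
    set T : ℝ := (katoMaximalTime ν u₀).toReal + 1 with hT_def
    have hT : 0 < T := by
      have h := (ENNReal.toReal_nonneg : 0 ≤ (katoMaximalTime ν u₀).toReal)
      rw [hT_def]; linarith
    have hno : ¬ ∃ (u : ℝ → EuclideanSpace ℝ (Fin 3) → EuclideanSpace ℝ (Fin 3))
        (p : ℝ → EuclideanSpace ℝ (Fin 3) → ℝ), IsTaoSolutionOn T ν u₀ u p := by
      rintro ⟨u, p, hup⟩
      have hle : ENNReal.ofReal T ≤ katoMaximalTime ν u₀ :=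
        clayOrBlowup_ofReal_le_katoMaximalTime hν hT hdec hup
      have hle' : T ≤ (katoMaximalTime ν u₀).toReal := (ENNReal.ofReal_le_iff_le_toReal htop).1 hle
      rw [hT_def] at hle'
      linarith
    obtain ⟨Ts, hTs0, -, u, p, hu0, hmax, hLH⟩ := stub_maximal ν hν T hT u₀ hsm hdiv hdec hno
    exact ⟨Ts, hTs0, u, p, hmax, hLH, hu0⟩

end Summit.NavierStokesRegularity.NavierStokesRegularity.Theorems.CertifiedBlowupAxisymBlowup.CompactAmplification

end
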